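import Literature.MathematicalPhysics.QuantumFieldTheory.BalabanImbrieJaffe1984to88.BIJ85Sect7Statements
import Literature.MathematicalPhysics.QuantumFieldTheory.Balaban1983to89.B5
import Literature.MathematicalPhysics.QuantumFieldTheory.Balaban1983to89.B4Sect5Torus

/-!
# `BalabanImbrieJaffe1984to88.BIJ85Ineq722Proof` — T. Bałaban, J. Imbrie, A. Jaffe, *Renormalization of the Higgs model: minimizers,
propagators and the stability of mean field theory*, Commun. Math. Phys. **97** (1985) 299–329 [BalabanImbrieJaffe1985]: Sect. 7.2 p. 325,
**(7.2.1)–(7.2.2)** — the kernel `H_{k,μν}(x; y)` of the Landau-gauge minimizer and the exponential decay of `H_k` and `∇H_k`, PROVED ALONG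
THE ROUTE THE PAPER CITES: *"This inequality is a consequence of Proposition 1.2 and the representation (1.103) of [6I]"* ([6I] =
[Balaban1984PropagatorsI], T. Bałaban, *Propagators and renormalization transformations for lattice gauge theories. I*, Commun. Math. Phys.
**95** (1984) 17–40: (1.103) `H_kB = GQ^*(QGQ^*)⁻¹B` p. 34, Proposition 1.2 (1.110)–(1.111) pp. 35–36, (1.100)–(1.101) p. 34, Proposition 1.1
p. 33), the decay of the unit-lattice factor `(QGQ^*)⁻¹` coming from *"the general theorem on unit lattice operators in [7]"* =
[Balaban1983RegularityDecay] Sect. 5, which enters AS PROVED in the tree (`…Balaban1983to89.B4Sect5Torus.inv_decay`).  File 1 of 2 (this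
file: the representation, `(QGQ^*)⁻¹`, and the `|H|`, `|∇H|` members of (7.2.2); file 2 = `…BIJ85Ineq722ProofPart2`: the Hölder member, the
cut-offs, Proposition 1.2 by its name in the tree, and the typed row `KernelData.Ineq722`).

statement-level skeleton of published theorems with citation tags; proofs where landed; nothing here is a claim about the Yang–Mills mass gap

PDF held: `paper:balaban1985-cmp97-bij-higgs-minimizers` (journal page = PDF page + 298; p. 325 = PDF 27, text layer read this session,
`lit read … --pages 25-29`) and `paper:balaban1984-cmp95-propagators-rt-i` (journal page = PDF page + 16; pp. 33–36 = PDF 17–20, text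
layer read this session).

CITATION HEADER (lean-in-tree rule).  Part of the lit-balaban TYPED SKELETON (HOME `run/shared/lean/pub/lit-balaban/`), Phase-2 seat p09
(gen 4; gens 1–3 = `BIJ85AxialPropagator411`, `BIJ85AxialMinimizer413`, `BIJ85SigmaForm421`, `BIJ85UnitPropagator433`, `BIJ85Prop521Proof`,
`BIJ85Ineq434Proof`); row **C1.Eq7.2.1-7.2.2** of `HOME/SKELETON.md` (typed `…BIJ85Sect7Statements.KernelData.Ineq722`, status *typed p239582
— claim by reference to B5 Prop 1.2 / (1.103)*; reader file `HOME/lit-balaban-r15/ROWS-C1.md`, owner r15, referee ref-5).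

THE PRINTED TEXT (verbatim).  [BalabanImbrieJaffe1985] p. 325 [PDF 27]: *"7.2. Regularity and Decay of Propagators and Minimizers. We are
interested in Landau gauge propagators and minimizers, because they have good regularity and decay. The key objects are H_k and C^{(k)},
while estimates on 𝒢_k follow by (4.4.4). The minimizer H_k can be expressed as an integral kernel. For x ∈ T_η, (H_kB)_μ(x) =
Σ_{y∈T₁^{(k)},ν} H_{k,μν}(x; y)B_ν(y). (7.2.1) The kernel H_{k,μν}(x,y) and its gradient decay exponentially. In particular there exists δ > 0
and for 0 ≤ α < 1 a constant M = M(α) < ∞ such that for |x − x′| ≤ 1, |H_{k,μν}(x,y)| + |∇H_{k,μν}(x,y)| + |x − x′|^{−α}|∇H_{k,μν}(x,y) −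
∇H_{k,μν}(x′,y)| ≤ Me^{−δ|x−y|}. (7.2.2) This inequality is a consequence of Proposition 1.2 and the representation (1.103) of [6I]."*
[Balaban1984PropagatorsI] p. 34 [PDF 18]: *"The operator a⁻¹(φ − 1)/φ has the momentum representation … (1.101) from which it follows that
it is bounded from below and above by positive constants dependent on d only (for a = 1). The same property holds for QGQ^*. The condition
QA = B gives the equation −QGQ^*ω = B, −ω = (QGQ^*)⁻¹B, (1.102) so finally we get the representation H_kB = GQ^*(QGQ^*)⁻¹B. (1.103) This
representation allows us to reduce a proof of properties of H_k to the corresponding properties of G."*; p. 33 [PDF 17]: *"Proposition 1.1.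
The operator G is a symmetric operator on L²(T_η) …"*; p. 35 [PDF 19]: *"Cubes Δ(y) are simply unit cubes of T_η, or Δ(y) = B(y), y ∈
T₁^{(k)}. Cubes Δ̃(y) are sums of 2^d unit cubes having the point y as a corner … Proposition 1.2. There exists a positive constant δ₀ depending
on d only, such that |(GJ)(x)|, |(∇GJ)(x)|, |(G∇^*J)(x)|, |(ΔGJ)(x)| ≤ O(1)e^{−δ₀|y−y′|}|J| (1.110) for x ∈ Δ̃(y), supp J ⊂ Δ̃(y′), with the
constant O(1) depending on d only, ‖ζ∇GJ‖_α, ‖ζG∇^*J‖_α ≤ O(1)e^{−δ₀|y−y′|}(‖ζ‖_α + |ζ|)|J| (1.111) for 0 ≤ α < 1, ζ ∈ C₀^∞(Δ̃(y)), supp J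
⊂ Δ̃(y′), with the constant O(1) depending on d and α (O(1) → ∞ if α → 1)"*.

WHAT IS PROVED, and how (finite index sets: fine sites `S` = T_η, unit sites `Y` = T₁^{(k)}, directions `Dir`; all operators as KERNELS —
`Rep103`: `G`, `∇G` (`DG`), `Q^*` (`Qs`), `Q = η^d(Q^*)ᵀ`; `QGQ^*` = `M`, `(QGQ^*)⁻¹` = `K`, and **`H_k := GQ^*(QGQ^*)⁻¹` (1.103) = `H`**,
`∇H_k = ∇GQ^*(QGQ^*)⁻¹` = `gradH`).
* §1 — the block decomposition `J = Σ_{y′} J1_{Δ(y′)}` (`blockRestr`, `supp J1_{Δ(y′)} ⊂ Δ(y′) ⊂ Δ̃(y′)`) through which Prop. 1.2 (stated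
  for `supp J ⊂ Δ̃(y′)`) applies to a general argument, the lattice convolution `Σ_{y′}e^{−a|y−y′|}e^{−b|y′−y₀|} ≤ KY(b/2)e^{−(b/2)|y−y₀|}`
  (`conv_exp_le`), and the basic consequence of (1.110) (`abs_G_apply_le`/`abs_DG_apply_le`): block norms `≤ Ae^{−b|y′−y₀|}` ⇒
  `|(GJ)(x)|, |(∇GJ)(x)| ≤ O(1)·A·KY(b/2)e^{−(b/2)|y_x−y₀|}`; locality of `Q^*` in exponential form (`norm_blockRestr_Qs_le`).
* §2 — the factor `(QGQ^*)⁻¹`: `QGQ^*` is symmetric (`M_isSymm`, from Prop. 1.1 *"G is a symmetric operator"*), its kernel decays,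
  `|(QGQ^*)(p, p′)| ≤ cM·e^{−(δ₀/2)|y_p − y_{p′}|}` (`abs_M_le`: (1.110) applied to the blocks of `Q^*δ_{p′}`), and it is bounded below
  ((1.100)–(1.101)); so it satisfies condition (5.6) of [7] Sect. 5 (`hyp56_M`) and THE PROVED Sect. 5 theorem (`B4Sect5Torus.inv_decay`)
  gives **`abs_K_le`**: `|(QGQ^*)⁻¹(p, p′)| ≤ (2/γ₁)e^{−δ₁|y_p − y_{p′}|}`, `δ₁ = rate1 …` a function of `(d, γ₁, q₀, q₁, r_Q, O(1), δ₀)` and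
  of the lattice-sum profile only; `M_mul_K`: `QGQ^*` is invertible, so (1.103) is meaningful.
* §3 — the `|H|` and `|∇H|` members of (7.2.2): `H_k(·; p₀) = G(Q^*(QGQ^*)⁻¹δ_{p₀})` (`H_apply`), the blocks of `Q^*(QGQ^*)⁻¹δ_{p₀}`
  decay like `q₀e^{δ₁r_Q}(2/γ₁)e^{−δ₁|y′−y₀|}` (`norm_blockRestr_QsK_le`), hence **`abs_H_le`**, **`abs_gradH_le`**:
  `|H_k(⟨x,μ⟩; ⟨y,ν⟩)|, |∇_λH_k| ≤ const722·e^{−δ|y_x − y|}` with `δ = rate722 = δ₁/2`, `const722 = O(1)q₀e^{δ₁r_Q}(2/γ₁)KY(δ)` —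
  functions of the input constants only, hence *"independent of k"* exactly when the inputs are, as [6I] states them (*"depending on d
  only"*).  `abs_H_le` is literally the displayed hypothesis `hH` of seat p08's `…BIJ85Ineq724Proof.abs_Dk_le` ((7.2.4) *"follows from
  (5.1.4) and (7.2.2)"*) with `ρ = |·−·|` on `T₁^{(k)}`.
HONEST SCOPE.  Proposition 1.2 of [6I] (row B5.Prop1.2: typed `…Balaban1983to89.B5.Prop12Printed`, NOT proved in the tree), the lower bound
(1.100)–(1.101) for `QGQ^*`, the symmetry clause of Proposition 1.1, and the structural facts about the averaging operators `Q`, `Q^*`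
((1.18): range `r_Q` — the fine bonds read by `Q` at `b` lie in the blocks of `b₋`, `b₊` —, bounded row sums) and the cubes enter as
HYPOTHESES OF THE PRINTED SHAPE (`Hyps`, `Prop12Hyps`; file 2
derives `Prop12Hyps` from `B5.Ineq110_114`/`B5.Prop12Printed` by name).  The Sect. 5 theorem of [7] is NOT a hypothesis.  That the kernel
`G` IS the propagator `G_k = Δ_a⁻¹` (1.71) of a concrete torus, and `H` the minimizer (4.4.2), is the instantiator's identification ((1.103) is
row B5.Eq1.103, proved in the tree on the `pub-balaban` carriers `…B5Eq191LagrangeG.el192_A_eq_Hk`); here `H := GQ^*(QGQ^*)⁻¹` by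
definition.  No new Prop-valued fact beyond the hypothesis bundles; nothing of the paper is asserted beyond the kernel-checked statements below.
Unit `lit-balaban-p09` (literature-prover-lit-balaban-p09-g4-0), 2026-08-21.
-/

namespace Literature.MathematicalPhysics.QuantumFieldTheory.BalabanImbrieJaffe1984to88.BIJ85Ineq722Proof

open Literature.MathematicalPhysics.QuantumFieldTheory.Balaban1983to89
open scoped BigOperators Matrix

noncomputable section

/-! ## §0  The data of one scale: `G`, `∇G`, `Q^*` as kernels; `QGQ^*`, `(QGQ^*)⁻¹`, `H_k = GQ^*(QGQ^*)⁻¹` (1.103) -/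

/-- The data of the representation (1.103) at one scale k ([6I] = [Balaban1984PropagatorsI] p. 34): fine sites `S` (= T_η), unit
sites `Y` (= T₁^{(k)}), directions `Dir`; vector fields on the fine lattice are indexed by `S × Dir` (the bond `⟨x, μ⟩`), on the unit
lattice by `Y × Dir`, gradients of fine vector fields by `S × Dir × Dir` (`(x, λ, μ)` ↦ `(∇_λA_μ)(x)`); the distances `|x − x′|` on
`T_η` (`dS`) and `|y − y′|` on `T₁^{(k)}` (`dY`); the block map `x ↦ y` with `x ∈ B(y) = Δ(y)` (`blk`); the doubled cubes `Δ̃(y)`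
(`cube`); the KERNELS of `G = G_k` ((1.71)), of `J ↦ ∇GJ` (`DG`) and of the adjoint averaging operator `Q^* = Q_k^*` (`Qs`), and
the weight `η^d` of the inner product `⟨A, B⟩ = Σ_x η^d A(x)·B(x)` on `T_η` with respect to which `Q^*` is the adjoint of `Q`
(`wη`; so `Q = η^d·(Q^*)ᵀ` as kernels, `Q`). [cite: BalabanImbrieJaffe1985, (7.2.1) p.325] -/
structure Rep103 where
  /-- fine sites x ∈ T_η -/
  S : Type
  /-- unit-lattice sites y ∈ T₁^{(k)} -/
  Y : Type
  /-- directions μ, ν, λ -/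
  Dir : Type
  [instFS : Fintype S]
  [instDS : DecidableEq S]
  [instFY : Fintype Y]
  [instDY : DecidableEq Y]
  [instFD : Fintype Dir]
  [instDD : DecidableEq Dir]
  /-- |x − x′| on T_η -/
  dS : S → S → ℝ
  /-- |y − y′| on T₁^{(k)} -/
  dY : Y → Y → ℝ
  /-- x ↦ the y with x ∈ B(y) = Δ(y) -/
  blk : S → Y
  /-- the doubled cube Δ̃(y) ⊂ T_η -/
  cube : Y → Set S
  /-- kernel of G: (GJ)_μ(x) = Σ G (x,μ) (x′,μ′) J_{μ′}(x′) -/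
  G : Matrix (S × Dir) (S × Dir) ℝ
  /-- kernel of J ↦ ∇GJ: (∇_λ(GJ)_μ)(x) = Σ DG (x,λ,μ) (x′,μ′) J_{μ′}(x′) -/
  DG : Matrix (S × Dir × Dir) (S × Dir) ℝ
  /-- kernel of Q^*: (Q^*w)_μ(x) = Σ Qs (x,μ) (y,ν) w_ν(y) -/
  Qs : Matrix (S × Dir) (Y × Dir) ℝ
  /-- the weight η^d -/
  wη : ℝ

namespace Rep103

attribute [instance] Rep103.instFS Rep103.instDS Rep103.instFY Rep103.instDY Rep103.instFD Rep103.instDD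

variable (R : Rep103)

/-- plumbing: fine vector-field indices `⟨x, μ⟩`. [cite: BalabanImbrieJaffe1985, (7.2.1) p.325] -/
abbrev ι : Type := R.S × R.Dir
/-- plumbing: unit-lattice vector-field indices `⟨y, ν⟩`. [cite: BalabanImbrieJaffe1985, (7.2.1) p.325] -/
abbrev κ : Type := R.Y × R.Dir
/-- plumbing: gradient indices `(x, λ, μ)`. [cite: BalabanImbrieJaffe1985, (7.2.2) p.325] -/
abbrev ιg : Type := R.S × R.Dir × R.Dir

/-- The averaging operator `Q = Q_k` as a kernel: the operator whose `⟨·,·⟩_η / ⟨·,·⟩`-adjoint is `Q^*`, i.e. `Q = η^d·(Q^*)ᵀ`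
(`⟨Q^*w, A⟩_η = η^dΣ(Q^*w)(x)A(x) = ⟨w, QA⟩`). [cite: Balaban1984PropagatorsI, (1.103) p.34] -/
def Q : Matrix R.κ R.ι ℝ := R.wη • R.Qsᵀ

/-- The unit-lattice operator `QGQ^*` of [6I] (1.99)–(1.102), as a kernel. [cite: Balaban1984PropagatorsI, (1.102) p.34] -/
def M : Matrix R.κ R.κ ℝ := R.Q * R.G * R.Qs

/-- `(QGQ^*)⁻¹` ([6I] (1.102): *"−ω = (QGQ^*)⁻¹B"*). [cite: Balaban1984PropagatorsI, (1.102) p.34] -/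
def K : Matrix R.κ R.κ ℝ := (R.M)⁻¹

/-- **The representation (1.103)** of [6I] p. 34, verbatim: *"so finally we get the representation H_kB = GQ^*(QGQ^*)⁻¹B. (1.103) This
representation allows us to reduce a proof of properties of H_k to the corresponding properties of G."* — the kernel `H_{k,μν}(x; y)`
of (7.2.1) p. 325 (*"(H_kB)_μ(x) = Σ_{y∈T₁^{(k)},ν} H_{k,μν}(x; y)B_ν(y)"*) IS the kernel of the composite `GQ^*(QGQ^*)⁻¹`.
[cite: BalabanImbrieJaffe1985, (7.2.1) p.325] -/
def H : Matrix R.ι R.κ ℝ := R.G * R.Qs * R.K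

/-- The kernel of `B ↦ ∇H_kB` (the `∇H_{k,μν}(x, y)` of (7.2.2)): `∇GQ^*(QGQ^*)⁻¹` by (1.103). [cite: BalabanImbrieJaffe1985, (7.2.2) p.325] -/
def gradH : Matrix R.ιg R.κ ℝ := R.DG * R.Qs * R.K

/-- The unit-lattice distance lifted to the unit vector-field indices (a pseudo-distance). [cite: BalabanImbrieJaffe1985, (7.2.2) p.325] -/
def ρκ : R.κ → R.κ → ℝ := fun p q => R.dY p.1 q.1

/-- The fine-lattice field `Q^*(QGQ^*)⁻¹δ_{p₀}` whose image under `G` is the column `H_k(·; p₀)` of the kernel (7.2.1).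
[cite: BalabanImbrieJaffe1985, (7.2.1) p.325] -/
def QsK (p₀ : R.κ) : R.ι → ℝ := R.Qs *ᵥ fun p => R.K p p₀

/-- Restriction of a fine vector field to the block (unit cube) `Δ(y′) = B(y′)`: `J·1_{Δ(y′)}` — the decomposition `J = Σ_{y′} J1_{Δ(y′)}`,
`supp J1_{Δ(y′)} ⊂ Δ(y′) ⊂ Δ̃(y′)`, through which Proposition 1.2 (stated for `supp J ⊂ Δ̃(y′)`) is applied to a general `J`.
[cite: Balaban1984PropagatorsI, (1.110) p.35] -/
def blockRestr (J : R.ι → ℝ) (y' : R.Y) : R.ι → ℝ := fun j => if R.blk j.1 = y' then J j else 0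

/-! ### The hypotheses of the printed derivation (one scale) -/

/-- The STRUCTURAL inputs of *"This inequality is a consequence of Proposition 1.2 and the representation (1.103) of [6I]"* at one
scale (everything except Proposition 1.2 itself, which is `Prop12Hyps`), at constants `γ₁` ((1.100)–(1.101)), `q₀, q₁, r_Q` (the averaging
operators) and a lattice-sum profile `KY`:
* `M_lower` — **[6I] (1.100)–(1.101)** p. 34: *"a⁻¹(φ − 1)/φ ≤ QGQ^* ≤ a⁻¹I (1.100) … it is bounded from below and above by positive
  constants dependent on d only (for a = 1). The same property holds for QGQ^*"* — the lower bound, as a quadratic-form inequality;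
* `G_symm` — **[6I] Proposition 1.1** p. 33: *"The operator G is a symmetric operator on L²(T_η)"* (for the uniform weight `η^d` of
  `L²(T_η)`: a symmetric kernel);
* `Qs_range`, `Qs_row`, `Q_row` — the averaging operators of [6I] (1.18) p. 20, *"(Q_kA)_b = Σ_{x∈B^k(b₋)} η^{d+1}A([x, x(b)]) … x(b) is a
  point in B^k(b₊) obtained from x by translation by b"*: the fine bonds read by `Q` at the unit bond `b` lie on the contours `[x, x + e_μ]`,
  `x ∈ B^k(b₋)`, hence in blocks within unit distance `r_Q` of `b₋` (`Q^*(⟨x′,μ′⟩, b) ≠ 0 ⇒ |y_{x′} − b₋| ≤ r_Q`), and the row sums of the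
  kernels of `Q^*`, `Q` are bounded (`|Q^*w| ≤ q₀|w|`, `|QA| ≤ q₁|A|`);
* `mem_cube_blk` — `x ∈ Δ(y) ⊂ Δ̃(y)` for the block `Δ(y) ∋ x` (p. 35: *"Cubes Δ(y) are simply unit cubes of T_η, or Δ(y) = B(y) … Cubes
  Δ̃(y) are sums of 2^d unit cubes having the point y as a corner"*);
* `dY_pd`, `sumY`, `dS_nonneg` — `|y − y′|` is a (pseudo-)distance on `T₁^{(k)}` with lattice sums `Σ_{y′}e^{−a|y−y′|} ≤ KY(a)`;
  `|x − x′| ≥ 0`.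
[cite: BalabanImbrieJaffe1985, (7.2.2) p.325] -/
structure Hyps (γ₁ q₀ q₁ rQ : ℝ) (KY : ℝ → ℝ) : Prop where
  γ₁_pos : 0 < γ₁
  q₀_nonneg : 0 ≤ q₀
  q₁_nonneg : 0 ≤ q₁
  rQ_nonneg : 0 ≤ rQ
  KY_nonneg : ∀ a, 0 < a → 0 ≤ KY a
  dY_pd : B4Sect5Torus.IsPseudoDist R.dY
  sumY : B4Sect5Torus.SumBound R.dY KY
  dS_nonneg : ∀ x x' : R.S, 0 ≤ R.dS x x'
  mem_cube_blk : ∀ x : R.S, x ∈ R.cube (R.blk x)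
  Qs_range : ∀ (j : R.ι) (p : R.κ), R.Qs j p ≠ 0 → R.dY (R.blk j.1) p.1 ≤ rQ
  Qs_row : ∀ j : R.ι, ∑ p, |R.Qs j p| ≤ q₀
  Q_row : ∀ p : R.κ, ∑ i, |R.Q p i| ≤ q₁
  G_symm : R.G.IsSymm
  M_lower : ∀ w : R.κ → ℝ, γ₁ * ∑ p, w p ^ 2 ≤ ∑ p, w p * (R.M *ᵥ w) p

/-- **The members of [6I] Proposition 1.2 used by the derivation**, at the printed constants `O(1) = C` ((1.110)), `O(1)(α) = Cα α`
((1.111)) and `δ₀`, verbatim p. 35 [PDF 19]: *"Proposition 1.2. There exists a positive constant δ₀ depending on d only, such that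
|(GJ)(x)|, |(∇GJ)(x)|, |(G∇^*J)(x)|, |(ΔGJ)(x)| ≤ O(1)e^{−δ₀|y−y′|}|J| (1.110) for x ∈ Δ̃(y), supp J ⊂ Δ̃(y′), with the constant O(1)
depending on d only, ‖ζ∇GJ‖_α, ‖ζG∇^*J‖_α ≤ O(1)e^{−δ₀|y−y′|}(‖ζ‖_α + |ζ|)|J| (1.111) for 0 ≤ α < 1, ζ ∈ C₀^∞(Δ̃(y)), supp J ⊂ Δ̃(y′),
with the constant O(1) depending on d and α (O(1) → ∞ if α → 1)"* — `e110_0`, `e110_1` = the first two members of (1.110) (`|J|` = the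
sup norm); `h111` = the first member of (1.111) read through the Hölder norm (1.109) `‖A‖_α = max_μ sup_{|x−x′|≤1} |x−x′|^{−α}|A_μ(x) −
A_μ(x′)|`: every Hölder quotient of `ζ∇GJ` (same component, `0 < |x − x′| ≤ 1`) is `≤ O(1)(α)e^{−δ₀|y−y′|}(Z_h + Z₀)|J|` whenever `‖ζ‖_α ≤
Z_h`, `|ζ| ≤ Z₀` (with `O(1)(α)` replaced by `max{O(1)(α), 0}`, which the printed inequality allows).  These three displayed inputs ARE
the corresponding conjuncts of the typed Proposition 1.2 of the tree, `…Balaban1983to89.B5.Ineq110_114`, for the carrier `settingOf` of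
file 2 (`prop12Hyps_of_ineq110_114` there); row B5.Prop1.2 of the skeleton is typed (`B5.Prop12Printed`), not proved, so they enter here
AS HYPOTHESES OF THE PRINTED SHAPE. [cite: Balaban1984PropagatorsI, Prop. 1.2 (1.110)–(1.111) p.35] -/
structure Prop12Hyps (C : ℝ) (Cα : ℝ → ℝ) (δ₀ : ℝ) : Prop where
  C_nonneg : 0 ≤ C
  δ₀_pos : 0 < δ₀
  e110_0 : ∀ (J : R.ι → ℝ) (y y' : R.Y), (∀ i, J i ≠ 0 → i.1 ∈ R.cube y') →
    ∀ i : R.ι, i.1 ∈ R.cube y → |(R.G *ᵥ J) i| ≤ C * Real.exp (-(δ₀ * R.dY y y')) * ‖J‖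
  e110_1 : ∀ (J : R.ι → ℝ) (y y' : R.Y), (∀ i, J i ≠ 0 → i.1 ∈ R.cube y') →
    ∀ g : R.ιg, g.1 ∈ R.cube y → |(R.DG *ᵥ J) g| ≤ C * Real.exp (-(δ₀ * R.dY y y')) * ‖J‖
  h111 : ∀ (α : ℝ) (J : R.ι → ℝ) (ζ : R.S → ℝ) (y y' : R.Y) (Zh Z0 : ℝ), 0 ≤ α → α < 1 → 0 ≤ Zh → 0 ≤ Z0 →
      (∀ x, ζ x ≠ 0 → x ∈ R.cube y) → (∀ i, J i ≠ 0 → i.1 ∈ R.cube y') →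
      (∀ x x', 0 < R.dS x x' → R.dS x x' ≤ 1 → |ζ x - ζ x'| ≤ Zh * R.dS x x' ^ α) → (∀ x, |ζ x| ≤ Z0) →
      ∀ g g' : R.ιg, g.2 = g'.2 → 0 < R.dS g.1 g'.1 → R.dS g.1 g'.1 ≤ 1 →
        |ζ g.1 * (R.DG *ᵥ J) g - ζ g'.1 * (R.DG *ᵥ J) g'| ≤
          max (Cα α) 0 * Real.exp (-(δ₀ * R.dY y y')) * (Zh + Z0) * ‖J‖ * R.dS g.1 g'.1 ^ α

/-! ## §1  The block decomposition and the basic consequence of (1.110); the lattice convolution -/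

variable {R}
variable {C δ₀ γ₁ q₀ q₁ rQ : ℝ} {KY : ℝ → ℝ} {Cα : ℝ → ℝ}

/-- `J = Σ_{y′} J1_{Δ(y′)}`. [cite: Balaban1984PropagatorsI, (1.110) p.35] -/
theorem sum_blockRestr (J : R.ι → ℝ) : ∑ y', R.blockRestr J y' = J := by
  funext j
  simp only [Finset.sum_apply, blockRestr, Finset.sum_ite_eq, Finset.mem_univ, if_true]

/-- `supp J1_{Δ(y′)} ⊂ Δ̃(y′)`. [cite: Balaban1984PropagatorsI, (1.110) p.35] -/
theorem blockRestr_supp (h : R.Hyps γ₁ q₀ q₁ rQ KY) (J : R.ι → ℝ) (y' : R.Y) (j : R.ι) (hj : R.blockRestr J y' j ≠ 0) :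
    j.1 ∈ R.cube y' := by
  unfold blockRestr at hj
  by_cases hb : R.blk j.1 = y'
  · rw [← hb]; exact h.mem_cube_blk j.1
  · exact absurd (if_neg hb) hj

/-- the sup norm of `J1_{Δ(y′)}` is controlled by `J` on the block. [cite: Balaban1984PropagatorsI, (1.110) p.35] -/
theorem norm_blockRestr_le {J : R.ι → ℝ} {y' : R.Y} {A : ℝ} (hA : 0 ≤ A) (hJ : ∀ j : R.ι, R.blk j.1 = y' → |J j| ≤ A) :
    ‖R.blockRestr J y'‖ ≤ A := by
  apply (pi_norm_le_iff_of_nonneg hA).2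
  intro j
  rw [Real.norm_eq_abs]
  unfold blockRestr
  by_cases hb : R.blk j.1 = y'
  · rw [if_pos hb]; exact hJ j hb
  · rw [if_neg hb, abs_zero]; exact hA

/-- moving the centre of an exponential weight by a bounded amount costs a factor `e^{δs}`. [folklore] -/
private theorem exp_shift {δ a b s : ℝ} (hδ : 0 ≤ δ) (hab : a ≤ s + b) :
    Real.exp (-(δ * b)) ≤ Real.exp (δ * s) * Real.exp (-(δ * a)) := by
  rw [← Real.exp_add]
  apply Real.exp_le_exp.2
  nlinarith [mul_le_mul_of_nonneg_left hab hδ]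

/-- **Lattice convolution of exponentials** (the summation over the intermediate unit site `y′` in `H = GQ^*(QGQ^*)⁻¹`):
`Σ_{y′} e^{−a|y−y′|}e^{−b|y′−y₀|} ≤ KY(b/2)·e^{−(b/2)|y−y₀|}` for `0 < b ≤ a` (the step producing the rate `δ` of (7.2.2) from `δ₀` and the
[7] Sect. 5 rate). [cite: BalabanImbrieJaffe1985, (7.2.2) p.325] -/
theorem conv_exp_le {Y : Type*} [Fintype Y] {ρ : Y → Y → ℝ} (hρ : B4Sect5Torus.IsPseudoDist ρ) {KY : ℝ → ℝ}
    (hS : B4Sect5Torus.SumBound ρ KY) {a b : ℝ} (hb : 0 < b) (hab : b ≤ a) (y y₀ : Y) :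
    ∑ y', Real.exp (-(a * ρ y y')) * Real.exp (-(b * ρ y' y₀)) ≤ KY (b / 2) * Real.exp (-(b / 2 * ρ y y₀)) := by
  have key : ∀ y', Real.exp (-(a * ρ y y')) * Real.exp (-(b * ρ y' y₀)) ≤
      Real.exp (-(b / 2 * ρ y y₀)) * Real.exp (-(b / 2 * ρ y y')) := by
    intro y'
    rw [← Real.exp_add, ← Real.exp_add]
    apply Real.exp_le_exp.2
    have h1 := hρ.triangle y y' y₀
    have h2 := hρ.nonneg y y'
    have h3 := hρ.nonneg y' y₀
    nlinarith [mul_nonneg hb.le h3, mul_le_mul_of_nonneg_left h1 hb.le, mul_nonneg (sub_nonneg.2 hab) h2]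
  calc ∑ y', Real.exp (-(a * ρ y y')) * Real.exp (-(b * ρ y' y₀))
      ≤ ∑ y', Real.exp (-(b / 2 * ρ y y₀)) * Real.exp (-(b / 2 * ρ y y')) := Finset.sum_le_sum fun y' _ => key y'
    _ = Real.exp (-(b / 2 * ρ y y₀)) * ∑ y', Real.exp (-(b / 2 * ρ y y')) := by rw [Finset.mul_sum]
    _ ≤ Real.exp (-(b / 2 * ρ y y₀)) * KY (b / 2) :=
        mul_le_mul_of_nonneg_left (hS (b / 2) (by linarith) y) (Real.exp_pos _).le
    _ = KY (b / 2) * Real.exp (-(b / 2 * ρ y y₀)) := mul_comm _ _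

/-- **The basic consequence of (1.110) for a general argument** `J`: if the restrictions of `J` to the unit cubes decay like
`|J1_{Δ(y′)}| ≤ Ae^{−b|y′ − y₀|}` (`0 < b ≤ δ₀`), then `|(GJ)(x)| ≤ O(1)·A·KY(b/2)·e^{−(b/2)|y_x − y₀|}` — by `GJ = Σ_{y′}GJ1_{Δ(y′)}`,
Prop. 1.2 (1.110) for each piece at `x ∈ Δ(y_x) ⊂ Δ̃(y_x)`, and the lattice convolution. [cite: Balaban1984PropagatorsI, (1.110) p.35] -/
theorem abs_G_apply_le (h : R.Hyps γ₁ q₀ q₁ rQ KY) (h12 : R.Prop12Hyps C Cα δ₀) {J : R.ι → ℝ} {A b : ℝ} {y₀ : R.Y}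
    (hA : 0 ≤ A) (hb : 0 < b) (hbδ : b ≤ δ₀) (hJ : ∀ y', ‖R.blockRestr J y'‖ ≤ A * Real.exp (-(b * R.dY y' y₀))) (i : R.ι) :
    |(R.G *ᵥ J) i| ≤ C * A * KY (b / 2) * Real.exp (-(b / 2 * R.dY (R.blk i.1) y₀)) := by
  have hsplit : (R.G *ᵥ J) i = ∑ y', (R.G *ᵥ R.blockRestr J y') i := by
    conv_lhs => rw [← sum_blockRestr J]
    rw [Matrix.mulVec_sum, Finset.sum_apply]
  have hCA : 0 ≤ C * A := mul_nonneg h12.C_nonneg hA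
  have hterm : ∀ y', |(R.G *ᵥ R.blockRestr J y') i| ≤
      C * A * (Real.exp (-(δ₀ * R.dY (R.blk i.1) y')) * Real.exp (-(b * R.dY y' y₀))) := by
    intro y'
    have h1 := h12.e110_0 (R.blockRestr J y') (R.blk i.1) y' (blockRestr_supp h J y') i (h.mem_cube_blk i.1)
    have hC0 : 0 ≤ C * Real.exp (-(δ₀ * R.dY (R.blk i.1) y')) := by have := h12.C_nonneg; positivity
    calc |(R.G *ᵥ R.blockRestr J y') i| ≤ C * Real.exp (-(δ₀ * R.dY (R.blk i.1) y')) * ‖R.blockRestr J y'‖ := h1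
      _ ≤ C * Real.exp (-(δ₀ * R.dY (R.blk i.1) y')) * (A * Real.exp (-(b * R.dY y' y₀))) :=
          mul_le_mul_of_nonneg_left (hJ y') hC0
      _ = _ := by ring
  rw [hsplit]
  calc |∑ y', (R.G *ᵥ R.blockRestr J y') i| ≤ ∑ y', |(R.G *ᵥ R.blockRestr J y') i| := Finset.abs_sum_le_sum_abs _ _
    _ ≤ ∑ y', C * A * (Real.exp (-(δ₀ * R.dY (R.blk i.1) y')) * Real.exp (-(b * R.dY y' y₀))) :=
        Finset.sum_le_sum fun y' _ => hterm y'
    _ = C * A * ∑ y', Real.exp (-(δ₀ * R.dY (R.blk i.1) y')) * Real.exp (-(b * R.dY y' y₀)) := by rw [Finset.mul_sum]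
    _ ≤ C * A * (KY (b / 2) * Real.exp (-(b / 2 * R.dY (R.blk i.1) y₀))) :=
        mul_le_mul_of_nonneg_left (conv_exp_le h.dY_pd h.sumY hb hbδ _ _) hCA
    _ = _ := by ring

/-- The same for the gradient kernel (the second member of (1.110)): `|(∇GJ)(x)| ≤ O(1)·A·KY(b/2)·e^{−(b/2)|y_x − y₀|}`.
[cite: Balaban1984PropagatorsI, (1.110) p.35] -/
theorem abs_DG_apply_le (h : R.Hyps γ₁ q₀ q₁ rQ KY) (h12 : R.Prop12Hyps C Cα δ₀) {J : R.ι → ℝ} {A b : ℝ} {y₀ : R.Y}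
    (hA : 0 ≤ A) (hb : 0 < b) (hbδ : b ≤ δ₀) (hJ : ∀ y', ‖R.blockRestr J y'‖ ≤ A * Real.exp (-(b * R.dY y' y₀))) (g : R.ιg) :
    |(R.DG *ᵥ J) g| ≤ C * A * KY (b / 2) * Real.exp (-(b / 2 * R.dY (R.blk g.1) y₀)) := by
  have hsplit : (R.DG *ᵥ J) g = ∑ y', (R.DG *ᵥ R.blockRestr J y') g := by
    conv_lhs => rw [← sum_blockRestr J]
    rw [Matrix.mulVec_sum, Finset.sum_apply]
  have hCA : 0 ≤ C * A := mul_nonneg h12.C_nonneg hA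
  have hterm : ∀ y', |(R.DG *ᵥ R.blockRestr J y') g| ≤
      C * A * (Real.exp (-(δ₀ * R.dY (R.blk g.1) y')) * Real.exp (-(b * R.dY y' y₀))) := by
    intro y'
    have h1 := h12.e110_1 (R.blockRestr J y') (R.blk g.1) y' (blockRestr_supp h J y') g (h.mem_cube_blk g.1)
    have hC0 : 0 ≤ C * Real.exp (-(δ₀ * R.dY (R.blk g.1) y')) := by have := h12.C_nonneg; positivity
    calc |(R.DG *ᵥ R.blockRestr J y') g| ≤ C * Real.exp (-(δ₀ * R.dY (R.blk g.1) y')) * ‖R.blockRestr J y'‖ := h1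
      _ ≤ C * Real.exp (-(δ₀ * R.dY (R.blk g.1) y')) * (A * Real.exp (-(b * R.dY y' y₀))) :=
          mul_le_mul_of_nonneg_left (hJ y') hC0
      _ = _ := by ring
  rw [hsplit]
  calc |∑ y', (R.DG *ᵥ R.blockRestr J y') g| ≤ ∑ y', |(R.DG *ᵥ R.blockRestr J y') g| := Finset.abs_sum_le_sum_abs _ _
    _ ≤ ∑ y', C * A * (Real.exp (-(δ₀ * R.dY (R.blk g.1) y')) * Real.exp (-(b * R.dY y' y₀))) :=
        Finset.sum_le_sum fun y' _ => hterm y'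
    _ = C * A * ∑ y', Real.exp (-(δ₀ * R.dY (R.blk g.1) y')) * Real.exp (-(b * R.dY y' y₀)) := by rw [Finset.mul_sum]
    _ ≤ C * A * (KY (b / 2) * Real.exp (-(b / 2 * R.dY (R.blk g.1) y₀))) :=
        mul_le_mul_of_nonneg_left (conv_exp_le h.dY_pd h.sumY hb hbδ _ _) hCA
    _ = _ := by ring

/-- **Locality of `Q^*` in exponential form**: a fine field `Q^*w` restricted to the block of `y′` only reads `w` at unit sites within `r_Q`
of `y′`, so if `|w(p)| ≤ Be^{−b|y_p − y₀|}` then `|(Q^*w)1_{Δ(y′)}| ≤ q₀e^{br_Q}·Be^{−b|y′ − y₀|}`. [cite: Balaban1984PropagatorsI, (1.18) p.20] -/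
theorem norm_blockRestr_Qs_le (h : R.Hyps γ₁ q₀ q₁ rQ KY) {w : R.κ → ℝ} {B b : ℝ} {y₀ : R.Y} (hB : 0 ≤ B) (hb : 0 ≤ b)
    (hw : ∀ p, |w p| ≤ B * Real.exp (-(b * R.dY p.1 y₀))) (y' : R.Y) :
    ‖R.blockRestr (R.Qs *ᵥ w) y'‖ ≤ q₀ * Real.exp (b * rQ) * B * Real.exp (-(b * R.dY y' y₀)) := by
  set E : ℝ := Real.exp (b * rQ) * B * Real.exp (-(b * R.dY y' y₀)) with hE
  have hE0 : 0 ≤ E := by positivity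
  have hgoal : ∀ j : R.ι, R.blk j.1 = y' → |(R.Qs *ᵥ w) j| ≤ q₀ * E := by
    intro j hj
    have hterm : ∀ p, |R.Qs j p * w p| ≤ |R.Qs j p| * E := by
      intro p
      rw [abs_mul]
      by_cases hq : R.Qs j p = 0
      · simp [hq]
      · apply mul_le_mul_of_nonneg_left _ (abs_nonneg _)
        have hr : R.dY (R.blk j.1) p.1 ≤ rQ := h.Qs_range j p hq
        rw [hj] at hr
        have hsh : Real.exp (-(b * R.dY p.1 y₀)) ≤ Real.exp (b * rQ) * Real.exp (-(b * R.dY y' y₀)) := by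
          apply exp_shift hb
          have := h.dY_pd.triangle y' p.1 y₀
          linarith
        calc |w p| ≤ B * Real.exp (-(b * R.dY p.1 y₀)) := hw p
          _ ≤ B * (Real.exp (b * rQ) * Real.exp (-(b * R.dY y' y₀))) := mul_le_mul_of_nonneg_left hsh hB
          _ = E := by rw [hE]; ring
    calc |(R.Qs *ᵥ w) j| = |∑ p, R.Qs j p * w p| := rfl
      _ ≤ ∑ p, |R.Qs j p * w p| := Finset.abs_sum_le_sum_abs _ _
      _ ≤ ∑ p, |R.Qs j p| * E := Finset.sum_le_sum fun p _ => hterm p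
      _ = (∑ p, |R.Qs j p|) * E := by rw [Finset.sum_mul]
      _ ≤ q₀ * E := mul_le_mul_of_nonneg_right (h.Qs_row j) hE0
  have := norm_blockRestr_le (mul_nonneg h.q₀_nonneg hE0) hgoal
  simpa only [hE, mul_assoc] using this

/-! ## §2  `QGQ^*`: symmetric, bounded below, with exponentially decaying kernel ⇒ `(QGQ^*)⁻¹` decays ([7] Sect. 5, PROVED) -/

/-- `QGQ^*` is symmetric (G symmetric, Q^* the adjoint of Q). [cite: Balaban1984PropagatorsI, (1.100) p.34] -/
theorem M_isSymm (hG : R.G.IsSymm) : R.M.IsSymm := by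
  unfold Matrix.IsSymm M Q
  rw [Matrix.transpose_mul, Matrix.transpose_mul, Matrix.transpose_smul, Matrix.transpose_transpose, hG.eq]
  simp only [Matrix.smul_mul, Matrix.mul_smul, Matrix.mul_assoc]

/-- The entries of `QGQ^*`: `(QGQ^*)(p, p′) = Σ_i Q(p, i)·(G Q^*δ_{p′})(i)`. [cite: Balaban1984PropagatorsI, (1.102) p.34] -/
theorem M_apply (p p' : R.κ) : R.M p p' = ∑ i, R.Q p i * (R.G *ᵥ fun j => R.Qs j p') i := by
  unfold M
  rw [Matrix.mul_assoc, Matrix.mul_apply]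
  rfl

/-- An entry of `Q^*` is bounded by the row sum: `|Q^*(i, p)| ≤ q₀`. [cite: Balaban1984PropagatorsI, (1.18) p.20] -/
theorem abs_Qs_le (h : R.Hyps γ₁ q₀ q₁ rQ KY) (i : R.ι) (p : R.κ) : |R.Qs i p| ≤ q₀ :=
  (Finset.single_le_sum (fun q _ => abs_nonneg (R.Qs i q)) (Finset.mem_univ p)).trans (h.Qs_row i)

/-- `Q(p, i) ≠ 0 ⇒` the block of `i` lies within `r_Q` of the unit site of `p` (`Q = η^d(Q^*)ᵀ`). [cite: Balaban1984PropagatorsI, (1.18) p.20] -/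
theorem Q_range (h : R.Hyps γ₁ q₀ q₁ rQ KY) {p : R.κ} {i : R.ι} (hq : R.Q p i ≠ 0) : R.dY (R.blk i.1) p.1 ≤ rQ := by
  apply h.Qs_range i p
  intro h0
  apply hq
  simp [Q, Matrix.smul_apply, Matrix.transpose_apply, h0]

/-- The blocks of the column `Q^*δ_{p′}`: `|(Q^*δ_{p′})1_{Δ(y′)}| ≤ q₀e^{δ₀r_Q}e^{−δ₀|y′ − y_{p′}|}` (it vanishes unless `|y′ − y_{p′}| ≤ r_Q`).
[cite: Balaban1984PropagatorsI, (1.18) p.20] -/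
theorem norm_blockRestr_QsCol_le (h : R.Hyps γ₁ q₀ q₁ rQ KY) (h12 : R.Prop12Hyps C Cα δ₀) (p' : R.κ) (y' : R.Y) :
    ‖R.blockRestr (fun j => R.Qs j p') y'‖ ≤ q₀ * Real.exp (δ₀ * rQ) * 1 * Real.exp (-(δ₀ * R.dY y' p'.1)) := by
  classical
  have hcol : (fun j => R.Qs j p') = R.Qs *ᵥ (fun p => if p = p' then (1 : ℝ) else 0) := by
    funext j
    simp only [Matrix.mulVec, dotProduct, mul_ite, mul_one, mul_zero, Finset.sum_ite_eq', Finset.mem_univ, if_true]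
  rw [hcol]
  apply norm_blockRestr_Qs_le h zero_le_one h12.δ₀_pos.le
  intro p
  by_cases hp : p = p'
  · subst hp
    simp [h.dY_pd.zero]
  · rw [if_neg hp, abs_zero]; positivity

/-- The constant `q₁·O(1)·q₀e^{δ₀r_Q}·KY(δ₀/2)·e^{(δ₀/2)r_Q}` of the kernel bound for `QGQ^*`. [cite: Balaban1984PropagatorsI, (1.102) p.34] -/
def cM (C δ₀ q₀ q₁ rQ : ℝ) (KY : ℝ → ℝ) : ℝ :=
  q₁ * (C * (q₀ * Real.exp (δ₀ * rQ) * 1) * KY (δ₀ / 2)) * Real.exp (δ₀ / 2 * rQ)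

/-- `cM ≥ 0`. [cite: Balaban1984PropagatorsI, (1.102) p.34] -/
theorem cM_nonneg (h : R.Hyps γ₁ q₀ q₁ rQ KY) (h12 : R.Prop12Hyps C Cα δ₀) : 0 ≤ cM C δ₀ q₀ q₁ rQ KY := by
  unfold cM
  have := h.q₀_nonneg; have := h.q₁_nonneg; have := h12.C_nonneg
  have := h.KY_nonneg _ (half_pos h12.δ₀_pos)
  positivity

/-- **The kernel of `QGQ^*` decays**: `|(QGQ^*)(p, p′)| ≤ cM·e^{−(δ₀/2)|y_p − y_{p′}|}` — from (1.110) (first member) applied to the blocks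
of `J = Q^*δ_{p′}` at the points read by `Q(p, ·)` (within `r_Q` of `y_p`). [cite: Balaban1984PropagatorsI, (1.110) p.35] -/
theorem abs_M_le (h : R.Hyps γ₁ q₀ q₁ rQ KY) (h12 : R.Prop12Hyps C Cα δ₀) (p p' : R.κ) :
    |R.M p p'| ≤ cM C δ₀ q₀ q₁ rQ KY * Real.exp (-(δ₀ / 2 * R.ρκ p p')) := by
  rw [M_apply]
  set A : ℝ := q₀ * Real.exp (δ₀ * rQ) * 1 with hA
  have hA0 : 0 ≤ A := by rw [hA]; have := h.q₀_nonneg; positivity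
  set B : ℝ := C * A * KY (δ₀ / 2) * Real.exp (δ₀ / 2 * rQ) * Real.exp (-(δ₀ / 2 * R.dY p.1 p'.1)) with hB
  have hB0 : 0 ≤ B := by
    rw [hB]; have := h12.C_nonneg; have := h.KY_nonneg _ (half_pos h12.δ₀_pos); positivity
  have hδ2 : 0 ≤ δ₀ / 2 := (half_pos h12.δ₀_pos).le
  have hterm : ∀ i, |R.Q p i * (R.G *ᵥ fun j => R.Qs j p') i| ≤ |R.Q p i| * B := by
    intro i
    rw [abs_mul]
    by_cases hq : R.Q p i = 0
    · simp [hq]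
    · apply mul_le_mul_of_nonneg_left _ (abs_nonneg _)
      have h1 := abs_G_apply_le h h12 hA0 h12.δ₀_pos le_rfl (norm_blockRestr_QsCol_le h h12 p') i
      have hsh : Real.exp (-(δ₀ / 2 * R.dY (R.blk i.1) p'.1)) ≤
          Real.exp (δ₀ / 2 * rQ) * Real.exp (-(δ₀ / 2 * R.dY p.1 p'.1)) := by
        apply exp_shift hδ2
        have h3 := h.dY_pd.triangle p.1 (R.blk i.1) p'.1
        have h4 := Q_range h hq
        rw [h.dY_pd.symm] at h4
        linarith
      have hC' : 0 ≤ C * A * KY (δ₀ / 2) := by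
        have := h12.C_nonneg; have := h.KY_nonneg _ (half_pos h12.δ₀_pos); positivity
      calc |(R.G *ᵥ fun j => R.Qs j p') i| ≤ C * A * KY (δ₀ / 2) * Real.exp (-(δ₀ / 2 * R.dY (R.blk i.1) p'.1)) := h1
        _ ≤ C * A * KY (δ₀ / 2) * (Real.exp (δ₀ / 2 * rQ) * Real.exp (-(δ₀ / 2 * R.dY p.1 p'.1))) :=
            mul_le_mul_of_nonneg_left hsh hC'
        _ = B := by rw [hB]; ring
  calc |∑ i, R.Q p i * (R.G *ᵥ fun j => R.Qs j p') i|
      ≤ ∑ i, |R.Q p i * (R.G *ᵥ fun j => R.Qs j p') i| := Finset.abs_sum_le_sum_abs _ _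
    _ ≤ ∑ i, |R.Q p i| * B := Finset.sum_le_sum fun i _ => hterm i
    _ = (∑ i, |R.Q p i|) * B := by rw [Finset.sum_mul]
    _ ≤ q₁ * B := mul_le_mul_of_nonneg_right (h.Q_row p) hB0
    _ = cM C δ₀ q₀ q₁ rQ KY * Real.exp (-(δ₀ / 2 * R.ρκ p p')) := by simp only [cM, hB, hA, ρκ]; ring

/-- The lifted unit-lattice distance is a pseudo-distance. [cite: BalabanImbrieJaffe1985, (7.2.2) p.325] -/
theorem ρκ_isPseudoDist (h : R.Hyps γ₁ q₀ q₁ rQ KY) : B4Sect5Torus.IsPseudoDist R.ρκ :=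
  h.dY_pd.comp Prod.fst

/-- Lattice sums over the unit vector-field indices: profile `|Dir|·KY`. [cite: BalabanImbrieJaffe1985, (7.2.2) p.325] -/
theorem ρκ_sumBound (h : R.Hyps γ₁ q₀ q₁ rQ KY) :
    B4Sect5Torus.SumBound R.ρκ (fun a => (Fintype.card R.Dir : ℝ) * KY a) := by
  intro a ha p
  simp only [ρκ]
  rw [Fintype.sum_prod_type]
  simp only [Finset.sum_const, Finset.card_univ, nsmul_eq_mul]
  rw [← Finset.mul_sum]
  exact mul_le_mul_of_nonneg_left (h.sumY a ha p.1) (Nat.cast_nonneg _)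

/-- **Condition (5.6) of [7] Sect. 5 for `QGQ^*`** (symmetric; bounded below by `γ₁`; kernel `≤ cM·e^{−(δ₀/2)|y−y′|}`) — whence *"the
general theorem on unit lattice operators in [7]"* applies to it. [cite: Balaban1984PropagatorsI, (1.102) p.34] -/
theorem hyp56_M (h : R.Hyps γ₁ q₀ q₁ rQ KY) (h12 : R.Prop12Hyps C Cα δ₀) :
    B4Sect5Torus.Hyp56 R.ρκ R.M γ₁ (cM C δ₀ q₀ q₁ rQ KY) (δ₀ / 2) :=
  ⟨R.M_isSymm h.G_symm, h.M_lower, abs_M_le h h12⟩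

/-- The (5.7)-rate of [7] Sect. 5 for `(QGQ^*)⁻¹`: `δ₁ = B4Sect5Torus.rate (|Dir|·KY) γ₁ cM (δ₀/2)` — a function of
`(d, γ₁, q₀, q₁, r_Q, O(1), δ₀, KY)` only. [cite: BalabanImbrieJaffe1985, (7.2.2) p.325] -/
def rate1 (nD : ℕ) (C δ₀ γ₁ q₀ q₁ rQ : ℝ) (KY : ℝ → ℝ) : ℝ :=
  B4Sect5Torus.rate (fun a => (nD : ℝ) * KY a) γ₁ (cM C δ₀ q₀ q₁ rQ KY) (δ₀ / 2)

/-- `δ₁ > 0`. [cite: BalabanImbrieJaffe1985, (7.2.2) p.325] -/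
theorem rate1_pos (h : R.Hyps γ₁ q₀ q₁ rQ KY) (h12 : R.Prop12Hyps C Cα δ₀) (nD : ℕ) : 0 < rate1 nD C δ₀ γ₁ q₀ q₁ rQ KY := by
  unfold rate1
  apply B4Sect5Torus.rate_pos
  · intro a ha; exact mul_nonneg (Nat.cast_nonneg _) (h.KY_nonneg a ha)
  · exact h.γ₁_pos
  · exact cM_nonneg h h12
  · exact half_pos h12.δ₀_pos

/-- `δ₁ ≤ δ₀`. [cite: BalabanImbrieJaffe1985, (7.2.2) p.325] -/
theorem rate1_le_δ₀ (h12 : R.Prop12Hyps C Cα δ₀) (nD : ℕ) (γ₁ q₀ q₁ rQ : ℝ) (KY : ℝ → ℝ) :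
    rate1 nD C δ₀ γ₁ q₀ q₁ rQ KY ≤ δ₀ :=
  (B4Sect5Torus.rate_le_delta0 _ _ _ (half_pos h12.δ₀_pos)).trans (by linarith [h12.δ₀_pos])

/-- **`(QGQ^*)⁻¹` has an exponentially decaying kernel**: `|(QGQ^*)⁻¹(p, p′)| ≤ (2/γ₁)e^{−δ₁|y_p − y_{p′}|}` — THE PROVED Sect. 5
theorem of [7] = [Balaban1983RegularityDecay] (`B4Sect5Torus.inv_decay`, finite Combes–Thomas) applied to `QGQ^*` under (5.6)
(`hyp56_M`). This is the step *"reduce a proof of properties of H_k to the corresponding properties of G"* needs for the factor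
`(QGQ^*)⁻¹` of (1.103). [cite: BalabanImbrieJaffe1985, (7.2.2) p.325] -/
theorem abs_K_le (h : R.Hyps γ₁ q₀ q₁ rQ KY) (h12 : R.Prop12Hyps C Cα δ₀) (p q : R.κ) :
    |R.K p q| ≤ 2 / γ₁ * Real.exp (-(rate1 (Fintype.card R.Dir) C δ₀ γ₁ q₀ q₁ rQ KY * R.dY p.1 q.1)) := by
  have hK : ∀ a, 0 < a → 0 ≤ (Fintype.card R.Dir : ℝ) * KY a :=
    fun a ha => mul_nonneg (Nat.cast_nonneg _) (h.KY_nonneg a ha)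
  exact B4Sect5Torus.inv_decay hK h.γ₁_pos (cM_nonneg h h12) (half_pos h12.δ₀_pos) (ρκ_isPseudoDist h) (ρκ_sumBound h)
    (hyp56_M h h12) p q

/-- `QGQ^*` is invertible (bounded below), so `(QGQ^*)⁻¹` IS its inverse: the representation (1.103) is meaningful.
[cite: Balaban1984PropagatorsI, (1.102) p.34] -/
theorem M_mul_K (h : R.Hyps γ₁ q₀ q₁ rQ KY) (h12 : R.Prop12Hyps C Cα δ₀) : R.M * R.K = 1 := by
  have hU : IsUnit R.M := B4Sect5Torus.isUnit_of_hyp56 h.γ₁_pos (hyp56_M h h12)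
  unfold K
  exact Matrix.mul_nonsing_inv _ ((Matrix.isUnit_iff_isUnit_det _).1 hU)

/-! ## §3  The `|H_{k,μν}(x, y)|` and `|∇H_{k,μν}(x, y)|` members of (7.2.2) -/

/-- The rate `δ = δ₁/2` of (7.2.2) produced by the derivation (`δ₁` = the [7] Sect. 5 rate of `(QGQ^*)⁻¹`); a function of
`(d, γ₁, q₀, q₁, r_Q, O(1), δ₀, KY)` only — *"there exists δ > 0"* independent of k. [cite: BalabanImbrieJaffe1985, (7.2.2) p.325] -/
def rate722 (nD : ℕ) (C δ₀ γ₁ q₀ q₁ rQ : ℝ) (KY : ℝ → ℝ) : ℝ := rate1 nD C δ₀ γ₁ q₀ q₁ rQ KY / 2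

/-- The constant `O(1)·(q₀e^{δ₁r_Q}(2/γ₁))·KY(δ)` bounding `|H|` and `|∇H|` in (7.2.2); a function of `(d, γ₁, q₀, q₁, r_Q, O(1), δ₀, KY)`
only. [cite: BalabanImbrieJaffe1985, (7.2.2) p.325] -/
def const722 (nD : ℕ) (C δ₀ γ₁ q₀ q₁ rQ : ℝ) (KY : ℝ → ℝ) : ℝ :=
  C * (q₀ * Real.exp (rate1 nD C δ₀ γ₁ q₀ q₁ rQ KY * rQ) * (2 / γ₁)) * KY (rate1 nD C δ₀ γ₁ q₀ q₁ rQ KY / 2)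

/-- `δ > 0`. [cite: BalabanImbrieJaffe1985, (7.2.2) p.325] -/
theorem rate722_pos (h : R.Hyps γ₁ q₀ q₁ rQ KY) (h12 : R.Prop12Hyps C Cα δ₀) (nD : ℕ) :
    0 < rate722 nD C δ₀ γ₁ q₀ q₁ rQ KY := by
  unfold rate722; have := rate1_pos h h12 nD; linarith

/-- The constant of (7.2.2) is nonnegative. [cite: BalabanImbrieJaffe1985, (7.2.2) p.325] -/
theorem const722_nonneg (h : R.Hyps γ₁ q₀ q₁ rQ KY) (h12 : R.Prop12Hyps C Cα δ₀) (nD : ℕ) :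
    0 ≤ const722 nD C δ₀ γ₁ q₀ q₁ rQ KY := by
  unfold const722
  have := h12.C_nonneg; have := h.q₀_nonneg; have := h.γ₁_pos
  have := h.KY_nonneg _ (half_pos (rate1_pos h h12 nD))
  positivity

/-- **(7.2.1) through (1.103)**: the column of the kernel `H_k` at the unit bond `p₀` is `G` applied to the fine-lattice field
`Q^*(QGQ^*)⁻¹δ_{p₀}`. [cite: BalabanImbrieJaffe1985, (7.2.1) p.325] -/
theorem H_apply (p₀ : R.κ) (i : R.ι) : R.H i p₀ = (R.G *ᵥ R.QsK p₀) i := by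
  unfold H QsK
  rw [Matrix.mul_assoc, Matrix.mul_apply]
  simp only [Matrix.mulVec, dotProduct, Matrix.mul_apply]

/-- The same for the gradient kernel: `∇H_k(·; p₀) = ∇G(Q^*(QGQ^*)⁻¹δ_{p₀})`. [cite: BalabanImbrieJaffe1985, (7.2.2) p.325] -/
theorem gradH_apply (p₀ : R.κ) (g : R.ιg) : R.gradH g p₀ = (R.DG *ᵥ R.QsK p₀) g := by
  unfold gradH QsK
  rw [Matrix.mul_assoc, Matrix.mul_apply]
  simp only [Matrix.mulVec, dotProduct, Matrix.mul_apply]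

/-- The blocks of `Q^*(QGQ^*)⁻¹δ_{p₀}` decay: `|(Q^*(QGQ^*)⁻¹δ_{p₀})1_{Δ(y′)}| ≤ q₀e^{δ₁r_Q}(2/γ₁)·e^{−δ₁|y′ − y_{p₀}|}` (locality of `Q^*`
and the decay of `(QGQ^*)⁻¹`). [cite: BalabanImbrieJaffe1985, (7.2.2) p.325] -/
theorem norm_blockRestr_QsK_le (h : R.Hyps γ₁ q₀ q₁ rQ KY) (h12 : R.Prop12Hyps C Cα δ₀) (p₀ : R.κ) (y' : R.Y) :
    ‖R.blockRestr (R.QsK p₀) y'‖ ≤ q₀ * Real.exp (rate1 (Fintype.card R.Dir) C δ₀ γ₁ q₀ q₁ rQ KY * rQ) * (2 / γ₁) *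
      Real.exp (-(rate1 (Fintype.card R.Dir) C δ₀ γ₁ q₀ q₁ rQ KY * R.dY y' p₀.1)) := by
  unfold QsK
  exact norm_blockRestr_Qs_le h (by have := h.γ₁_pos; positivity) (rate1_pos h h12 _).le (fun p => abs_K_le h h12 p p₀) y'

/-- **The `|H_{k,μν}(x, y)|` member of (7.2.2)**: `|H_k(⟨x,μ⟩; ⟨y,ν⟩)| ≤ const722·e^{−δ|y_x − y|}` (`y_x` = the unit site of the block of
`x`; `δ = rate722`) — Prop. 1.2 (1.110) for the blocks of `Q^*(QGQ^*)⁻¹δ_{⟨y,ν⟩}` at `x ∈ Δ(y_x) ⊂ Δ̃(y_x)` and the lattice convolution.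
This is exactly the displayed hypothesis `hH` of `…BIJ85Ineq724Proof.abs_Dk_le` ((7.2.4) *"follows from (5.1.4) and (7.2.2)"*, seat p08)
with `ρ = |·−·|` on `T₁^{(k)}`. [cite: BalabanImbrieJaffe1985, (7.2.2) p.325] -/
theorem abs_H_le (h : R.Hyps γ₁ q₀ q₁ rQ KY) (h12 : R.Prop12Hyps C Cα δ₀) (i : R.ι) (p₀ : R.κ) :
    |R.H i p₀| ≤ const722 (Fintype.card R.Dir) C δ₀ γ₁ q₀ q₁ rQ KY *
      Real.exp (-(rate722 (Fintype.card R.Dir) C δ₀ γ₁ q₀ q₁ rQ KY * R.dY (R.blk i.1) p₀.1)) := by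
  rw [H_apply]
  have h1 := abs_G_apply_le h h12 (by have := h.q₀_nonneg; have := h.γ₁_pos; positivity) (rate1_pos h h12 _)
    (rate1_le_δ₀ h12 _ _ _ _ _ _) (norm_blockRestr_QsK_le h h12 p₀) i
  unfold const722 rate722
  exact h1

/-- **The `|∇H_{k,μν}(x, y)|` member of (7.2.2)**: `|∇_λH_k((x,λ,μ); ⟨y,ν⟩)| ≤ const722·e^{−δ|y_x − y|}` — the same with the second member
of (1.110). [cite: BalabanImbrieJaffe1985, (7.2.2) p.325] -/
theorem abs_gradH_le (h : R.Hyps γ₁ q₀ q₁ rQ KY) (h12 : R.Prop12Hyps C Cα δ₀) (g : R.ιg) (p₀ : R.κ) :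
    |R.gradH g p₀| ≤ const722 (Fintype.card R.Dir) C δ₀ γ₁ q₀ q₁ rQ KY *
      Real.exp (-(rate722 (Fintype.card R.Dir) C δ₀ γ₁ q₀ q₁ rQ KY * R.dY (R.blk g.1) p₀.1)) := by
  rw [gradH_apply]
  have h1 := abs_DG_apply_le h h12 (by have := h.q₀_nonneg; have := h.γ₁_pos; positivity) (rate1_pos h h12 _)
    (rate1_le_δ₀ h12 _ _ _ _ _ _) (norm_blockRestr_QsK_le h h12 p₀) g
  unfold const722 rate722
  exact h1

end Rep103

end

end Literature.MathematicalPhysics.QuantumFieldTheory.BalabanImbrieJaffe1984to88.BIJ85Ineq722Proof
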